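import Summits.CriticalPhenomena.Ising3D.Control2DReadoutCheck
import Summits.CriticalPhenomena.Ising3D.Control2DPolyCertAuto
import Mathlib.Tactic.Linarith
import Mathlib.Tactic.Positivity
import Mathlib.Tactic.FieldSimp
import Mathlib.Tactic.Ring
import HarnessLib

/-!
# Readout certificates over a WINDOW: the dip value is beaten on a whole interval of dimensions (Bernstein in the kernel)
(cell `pub-ising3x`, seat controls-1 gen 29; KERNEL PATH, certificate kind "readout", continuum form — CONTROL-ONLY)

HONEST FRAMING: lottery ticket; floor = tightest certified 3D Ising CFT bounds; no exact-solution
claim without a proof. CONTROL-ONLY (`d = 2`, `Δ_σ = 1/8`); nothing numerical is asserted here.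

The point readout (`Control2DReadoutCheck`) compares `f(Δ) = φ[F^{1/8}_-[g_{Δ,0}]]` at finitely many `Δ`. This file certifies
`f(m) < f(Δ)` for EVERY `Δ` of a cell `[2a/q, 2(a+L)/q]` below `m`, so that the readout's near-zero at `m` is the least value over a
whole window — the continuum content of "first excited dip at `m`". Ingredients, all in the tree: the truncated action is bounded
BELOW by the full one when the dropped pairs are non-negative (`phi_QN_le_block_taylor` under the certificate's region obligation
(R), `Δ + N ≥ E₀`); the truncated action is the integer cell polynomial over a positive factor (`evalR_cellPolyZ`:
`P̂(y) = C·D(y)²·halfPow(Δ)⁻¹ · φ[F_-[Q_{Nd+1}(Δ,0)]]`, `y = Δ/2`, `C = 8^Λ Λ!² 4^{Nd}`, `D = denProd`); the dip's UPPER enclosure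
`f(m) ≤ halfPow(m)·U` (`blockAction0_mem`, `U = headQv + errQ`); and Bernstein positivity decided in the kernel (`bernAuto`, with `ptrunc`)
of the WINDOW POLYNOMIAL `G = P̂ − B·D²`, `B = ⌊U·C⌋ + 1 ≥ U·C`, on its leading digits (`ptrunc G t`) ⇒ `P̂(y)/(C D(y)²) ≥ U` ⇒ `f(Δ) ≥ halfPow(Δ)·U > halfPow(m)·U ≥ f(m)`
for `Δ < m`. ONE Boolean `windowCheck … = true` (`window_lt_of_windowCheck`). Elementary; no facts, standard axioms only.
[cite: RattazziEtAl2008, §5.5]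
-/

namespace Summit.CriticalPhenomena.Ising3D.Control2D

open Finset Set
open Literature.Analysis.ValidatedNumerics.PolyMP
open Literature.MathematicalPhysics.QuantumFieldTheory.ConformalBootstrap3D

/-- The common denominator `D(y) = ∏_{i<Nd} den_i(y + c)` as an integer coefficient list. [folklore] -/
def denProdZ (Nd c : ℕ) : List ℤ := zprodRange (denZ c) Nd

/-- [folklore] -/
theorem evalR_denProdZ (Nd c : ℕ) (y : ℝ) : evalR (castZ (denProdZ Nd c)) y = denProd Nd c y := by
  rw [denProdZ, evalR_zprodRange]; rfl

/-- `cellConst` for the scalar channel, factored: `C · D(y)² · (halfPow Δ)⁻¹` with `C = 8^Λ Λ!² 4^{Nd}`, `y = Δ/2`. [folklore] -/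
theorem cellConst_zero_eq (Λ Nd : ℕ) (Δ : ℝ) :
    cellConst Λ 0 Nd Δ =
      (8 : ℝ) ^ Λ * (Λ.factorial : ℝ) * (Λ.factorial : ℝ) * (4 : ℝ) ^ Nd *
        (denProd Nd 0 (Δ / 2) * denProd Nd 0 (Δ / 2)) * (halfPow Δ)⁻¹ := by
  unfold cellConst halfPow
  simp only [Nat.cast_zero, sub_zero]
  ring

/-- `C = 8^Λ Λ!² 4^{Nd}`, the integer part of `cellConst`. [folklore] -/
def cellConstZ (Λ Nd : ℕ) : ℤ := (8 : ℤ) ^ Λ * (Λ.factorial : ℤ) * (Λ.factorial : ℤ) * (4 : ℤ) ^ Nd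

/-- The integer multiplier `B = ⌊U·C⌋ + 1 ≥ U·C` of the window polynomial. [folklore] -/
def windowMult (Λ Nd : ℕ) (U : ℚ) : ℤ := U.num * cellConstZ Λ Nd / (U.den : ℤ) + 1

/-- **The window polynomial** `G = P̂ − B·D(y)²`, `B = windowMult Λ Nd U`. [folklore] -/
def windowPolyZ (P : List ℤ) (Λ Nd : ℕ) (U : ℚ) : List ℤ :=
  zadd P (zsmul (-windowMult Λ Nd U) (zmul (denProdZ Nd 0) (denProdZ Nd 0)))

/-- **The window check** (`Δ_σ = 1/8`, scalar channel) for the integer table `wt` on `Sl` with cell polynomial `P = cellPolyZ wt Sl Λ 0 Nd`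
(supplied as a literal), readout truncation `N`, dip point `m`, cell `[a/q, (a+L)/q]` in `y = Δ/2`, region threshold `E₀`, digit cut `t`:
positivity of the dip's upper enclosure `U`, the rounding inequality `U·C ≤ B`, ranges, `2(a+L)/q < m`, `E₀ ≤ 2a/q + Nd + 1`, and
`bernAuto (ptrunc (windowPolyZ P Λ Nd U) t) q a L` (the leading digits decide, as in the landed cells). [folklore] -/
def windowCheck (wt : ℕ × ℕ → ℤ) (Sl : List (ℕ × ℕ)) (Λ Nd t N E₀ : ℕ) (m : ℚ) (q a L : ℤ) (P : List ℤ) : Bool :=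
  let U : ℚ := headQv wt Sl (1 / 8) (m / 2) N Λ + errQ wt Sl m N Λ
  decide (0 < U) && decide (U * (cellConstZ Λ Nd : ℚ) ≤ (windowMult Λ Nd U : ℚ)) &&
    decide (0 < q) && decide (0 ≤ a) && decide (0 ≤ L) && rangeOk m && decide (Λ < N + 5) &&
    decide (2 * ((a : ℚ) + L) / q < m) && decide ((E₀ : ℚ) ≤ 2 * (a : ℚ) / q + (Nd + 1)) &&
    bernAuto (ptrunc (windowPolyZ P Λ Nd U) t) q a L

/-- **Soundness of the window check**: with `P = cellPolyZ wt Sl Λ 0 Nd` and the certificate's region obligation (R) at threshold `E₀`,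
`windowCheck … = true` gives `f(m) < f(Δ)` for every `Δ ∈ [2a/q, 2(a+L)/q]` (`f(x) = φ[F^{1/8}_-[g_{x,0}]]`,
`φ = taylorFunctional2D (1/2) Sl.toFinset wt`). [cite: RattazziEtAl2008, §5.5] -/
theorem window_lt_of_windowCheck (wt : ℕ × ℕ → ℤ) {Sl : List (ℕ × ℕ)} (hnd : Sl.Nodup) {Λ : ℕ}
    (hdeg : ∀ p ∈ Sl, p.1 + p.2 ≤ Λ) {Nd t N E₀ : ℕ} {m : ℚ} {q a L : ℤ} {P : List ℤ}
    (hP : cellPolyZ wt Sl Λ 0 Nd = P)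
    (hR : ∀ (b : ℝ) (J : ℕ), 0 ≤ b → (E₀ : ℝ) ≤ 2 * b + J →
      0 ≤ ∑ p ∈ Sl.toFinset, (wt p : ℝ) * ((1 - (-1 : ℝ) ^ (p.1 + p.2)) * 2 ^ (p.1 + p.2) *
        (qFactor₁ (1 / 8) (b + J) p.1 * qFactor₁ (1 / 8) b p.2 + qFactor₁ (1 / 8) b p.1 * qFactor₁ (1 / 8) (b + J) p.2)))
    (hchk : windowCheck wt Sl Λ Nd t N E₀ m q a L P = true) {Δ : ℝ}
    (hlo : 2 * (a : ℝ) / q ≤ Δ) (hhi : Δ ≤ 2 * ((a : ℝ) + L) / q) :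
    taylorFunctional2D (1 / 2) Sl.toFinset (fun p => (wt p : ℝ)) (crossF (1 / 8) (-1) (globalBlock (m : ℝ) 0)) <
      taylorFunctional2D (1 / 2) Sl.toFinset (fun p => (wt p : ℝ)) (crossF (1 / 8) (-1) (globalBlock Δ 0)) := by
  set φ := taylorFunctional2D (1 / 2) Sl.toFinset (fun p => (wt p : ℝ)) with hφdef
  unfold windowCheck at hchk
  simp only [Bool.and_eq_true, decide_eq_true_eq, headQv_eq_headQ wt hdeg] at hchk
  obtain ⟨⟨⟨⟨⟨⟨⟨⟨⟨hU0, hB⟩, hq⟩, ha⟩, hL⟩, hm⟩, hN⟩, htop⟩, hE⟩, hbern⟩ := hchk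
  set U : ℚ := headQ wt Sl (1 / 8) (m / 2) N + errQ wt Sl m N Λ with hUdef
  obtain ⟨hm0, hm6, hmq⟩ := rangeOk_sound hm
  -- real casts of the check's facts
  have hqR : (0 : ℝ) < q := by exact_mod_cast hq
  have haR : (0 : ℝ) ≤ a := by exact_mod_cast ha
  have hy0 : 0 ≤ Δ / 2 := by
    have : 0 ≤ 2 * (a : ℝ) / q := by positivity
    linarith
  have hΔm : Δ < (m : ℝ) := by
    have h1 : (((2 * ((a : ℚ) + L) / q : ℚ)) : ℝ) < (m : ℝ) := by exact_mod_cast htop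
    push_cast at h1
    linarith
  have hEΔ : (E₀ : ℝ) ≤ Δ + ((Nd + 1 : ℕ) : ℝ) := by
    have h1 : (((E₀ : ℚ)) : ℝ) ≤ (((2 * (a : ℚ) / q + (Nd + 1) : ℚ)) : ℝ) := by exact_mod_cast hE
    push_cast at h1 ⊢
    linarith
  -- (1) the dip's upper enclosure
  obtain ⟨-, hUm⟩ := blockAction0_mem wt hnd hdeg hm0 hm6 hmq hN
  have hUpos : (0 : ℝ) < (U : ℝ) := by exact_mod_cast hU0
  -- (2) the window polynomial is non-negative at `y = Δ/2`
  have hG := evalR_nonneg_of_bernAuto hq hL hbern (x := Δ / 2)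
    (by
      have e : (a : ℝ) / q = (2 * (a : ℝ) / q) / 2 := by ring
      rw [e]; linarith)
    (by
      have e : ((a : ℝ) + L) / q = (2 * ((a : ℝ) + L) / q) / 2 := by ring
      rw [e]; linarith)
  -- unfold its value
  set C : ℤ := cellConstZ Λ Nd with hCdef
  set B : ℤ := windowMult Λ Nd U with hBdef
  have hCR : ((C : ℤ) : ℝ) = (8 : ℝ) ^ Λ * (Λ.factorial : ℝ) * (Λ.factorial : ℝ) * (4 : ℝ) ^ Nd := by
    rw [hCdef, cellConstZ]; push_cast; ring
  have hCpos : (0 : ℝ) < ((C : ℤ) : ℝ) := by rw [hCR]; positivity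
  set Dv : ℝ := denProd Nd 0 (Δ / 2) with hDv
  have hDpos : 0 < Dv := denProd_pos Nd 0 (by push_cast; linarith)
  have hGval : evalR (castZ (windowPolyZ P Λ Nd U)) (Δ / 2) = evalR (castZ P) (Δ / 2) - (B : ℝ) * (Dv * Dv) := by
    rw [windowPolyZ, evalR_zadd, evalR_zsmul, evalR_zmul, evalR_denProdZ, ← hBdef]
    push_cast
    ring
  -- (3) truncation and rounding: `P̂(y) ≥ B·D² ≥ U·C·D²`
  have htr := pow_mul_evalR_ptrunc_le t hy0 (windowPolyZ P Λ Nd U)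
  rw [hGval] at htr
  have hBR : ((U : ℚ) : ℝ) * ((C : ℤ) : ℝ) ≤ ((B : ℤ) : ℝ) := by exact_mod_cast hB
  have hPy : (U : ℝ) * ((C : ℤ) : ℝ) * (Dv * Dv) ≤ evalR (castZ P) (Δ / 2) := by
    have h10 : (0 : ℝ) < (10 : ℝ) ^ t := by positivity
    have hDD : 0 ≤ Dv * Dv := by positivity
    nlinarith [mul_le_mul_of_nonneg_right hBR hDD, mul_nonneg h10.le hG]
  -- (4) `P̂(y) = cellConst · φ[F[Q]]`, `cellConst = C·D²·halfPow⁻¹`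
  have hΔ0 : ((0 : ℕ) : ℝ) ≤ Δ := by push_cast; linarith
  have hcell := evalR_cellPolyZ wt hnd hdeg 0 Nd hΔ0
  rw [hP] at hcell
  have hy : (Δ - ((0 : ℕ) : ℝ)) / 2 = Δ / 2 := by push_cast; ring
  rw [hy, cellConst_zero_eq, ← hCR, ← hDv] at hcell
  have hhp := halfPow_pos Δ
  -- φ[F[Q]] ≥ halfPow Δ · U
  have hQ : (U : ℝ) * halfPow Δ ≤ φ (crossF (1 / 8) (-1) (QN (Nd + 1) 0 Δ)) := by
    set φQ : ℝ := φ (crossF (1 / 8) (-1) (QN (Nd + 1) 0 Δ)) with hφQ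
    have hpos : 0 < ((C : ℤ) : ℝ) * (Dv * Dv) := by positivity
    have h1 : (U : ℝ) * (((C : ℤ) : ℝ) * (Dv * Dv)) ≤ ((halfPow Δ)⁻¹ * φQ) * (((C : ℤ) : ℝ) * (Dv * Dv)) := by
      calc (U : ℝ) * (((C : ℤ) : ℝ) * (Dv * Dv)) = (U : ℝ) * ((C : ℤ) : ℝ) * (Dv * Dv) := by ring
        _ ≤ evalR (castZ P) (Δ / 2) := hPy
        _ = ((halfPow Δ)⁻¹ * φQ) * (((C : ℤ) : ℝ) * (Dv * Dv)) := by rw [hcell]; ring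
    have h2 : (U : ℝ) ≤ (halfPow Δ)⁻¹ * φQ := le_of_mul_le_mul_right h1 hpos
    calc (U : ℝ) * halfPow Δ ≤ ((halfPow Δ)⁻¹ * φQ) * halfPow Δ := mul_le_mul_of_nonneg_right h2 hhp.le
      _ = φQ := by field_simp
  -- (5) truncation is a lower bound (dropped pairs ≥ 0 under (R))
  have hpair : PairPositiveAbove φ (1 / 8) E₀ := pairPositiveAbove_half_of_poly Sl.toFinset _ hR
  have hle := phi_QN_le_block_taylor (isTaylorFunctional_taylorFunctional2D (1 / 2) Sl.toFinset _) (by norm_num)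
    (by norm_num) hpair (ℓ := 0) (N := Nd + 1) hΔ0 hEΔ
  -- (6) compare with the dip
  have hlt : (U : ℝ) * halfPow (m : ℝ) < (U : ℝ) * halfPow Δ :=
    mul_lt_mul_of_pos_left (halfPow_lt_halfPow hΔm) hUpos
  calc φ (crossF (1 / 8) (-1) (globalBlock (m : ℝ) 0))
      ≤ halfPow (m : ℝ) * ((headQ wt Sl (1 / 8) (m / 2) N + errQ wt Sl m N Λ : ℚ) : ℝ) := hUm
    _ = (U : ℝ) * halfPow (m : ℝ) := by rw [hUdef]; ring
    _ < (U : ℝ) * halfPow Δ := hlt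
    _ ≤ φ (crossF (1 / 8) (-1) (QN (Nd + 1) 0 Δ)) := hQ
    _ ≤ φ (crossF (1 / 8) (-1) (globalBlock Δ 0)) := hle

end Summit.CriticalPhenomena.Ising3D.Control2D
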